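import Summits.CriticalPhenomena.PercolationContinuityZ3.Theorems.PercNearOneGluingNoHeavyQuantLongTailTripleHubAlgWide
import Summits.CriticalPhenomena.PercolationContinuityZ3.Theorems.PercNearOneGluingNoHeavyQuantLongTailTripleTopAlgTwo
import Summits.CriticalPhenomena.PercolationContinuityZ3.Theorems.PercNearOneGluingNoHeavyQuantLongTailTripleTopAlgThree
import HarnessLib

/-!
# QUANT lane R8, T-DEC: THE LONG-TAIL TRIPLE HUB BEYOND `3lo` — the torque-cost inequalities of the THREE-BRANCH rule (second branch; two lows) for the width-3 hub
# `S(γ₁) ∗ S(γ₂) ∗ S(γ₃)` of shape `{lo, lo+K; γ}` with `3lo ≤ K ≤ 7lo/2` (census-1 gen 33)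

builds on p205010 (kernel theorem, internal audit signed; external expert review pending)

Support file (`--supports stmt-CriticalPhenomena-4575`), QUANT lane seat prim-quant-census-1 (gen 33); memo
`run/shared/lean/prim/quant/prim-quant-census-1/g33/WIDE3-G33.md`.  Theorems only, standard axioms, no sorries.  Pure real algebra: the floor
parts (`θ = y`) of the torque costs of the three cost routes of the width-3 long-tail hub beyond `3lo`, each reduced to a CONCAVE quadratic in the
gated mean `T` and checked at the ends of its interval from gen 32's kernel certificates (`…TripleHubAlgWide`, `…TripleTopAlg`, `…TripleTopAlgTwo`,
`…TripleTopAlgThree`).  Notation: gates `g₁ ≤ g₂, g₃` in `[lo/K, 1)`, `u₀ = (1−g₁)(1−g₂)(1−g₃)`, `u₁ = Σ gᵢ(1−gⱼ)(1−gₖ)`, `u₂ = Σ gᵢgⱼ(1−gₖ)`,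
`u₃ = g₁g₂g₃`, `T₀ = 3lo + K(g₁+g₂+g₃) < 3lo+3K`, floor `x(lo+K) ≤ lo+Kg₁`, switching point `τ = 6lo + K·u₁/(u₀+u₁)` (middle-low credit exhausted).
THE RULE (memo §1; exact-rational regression `g33/code/exp1_threebranch.py`, 0 failures): ONE LOW (`6lo < T ≤ 6lo+2K`): the low `3lo` goes to `3lo+K`
while `(T−6lo)(u₀+u₁) ≤ K·u₁`, else to `3lo+2K` while `(T−6lo)(u₀+u₂) ≤ 2K·u₂`, else to the top `3lo+3K`; TWO LOWS (`T > 6lo+2K`): both lows `3lo`,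
`3lo+K` go to the top.
* **`tripleWide_costMid`** — second branch, `T < 3lo+2K` (the wide twin of gen 32's `tripleHubLong_costTop`, now from `ltTriple_capTop_wide` /
  `ltTriple_cost0_wide`, `3lo ≤ K ≤ 4lo`): `0 ≤ (T₀ − xT)(u₀(T−3lo) + u₁(T−3lo−K)) − (3lo+2K−T)·xT·u₀` on `[τ, min(T₀, 3lo+2K)]`.
* (companion file `…QuantLongTailTripleWideCostTop`: `tripleWide_costTopOne`, the third branch — one low to the top.)
* **`tripleWide_costTopTwo`** — two lows to the top: `0 ≤ (T₀ − xT)(u₀(T−3lo) + u₁(T−3lo−K) + u₂(T−3lo−2K)) − (3lo+3K−T)·xT·(u₀+u₁)` on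
  `[6lo+2K, T₀]` (left end `ltTop_cost2_max`, right end the torque identity and `ltTop_capTop_two`).

HONEST STATUS.  Algebra only; the route and the SDEC theorem are `…QuantLongTailTripleWideRoute` / `…QuantLongTailTripleWideHub`.  `SiblingStep`,
`GluedDominatedMass`, `SDECConvClosed`, `FarTreeRow` OPEN; RATE class (log\*) / honest sentence of `run/shared/lean/prim/quant/README.md` unchanged.
[this work].  Nothing here is cited as a published result.  The gluing rows served [cite: KozmaNitzan2024, Conjecture 3 (p. 15)]; product measure
[cite: Grimmett1999, §1.3 p. 10].
-/

noncomputable section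

namespace Summit.CriticalPhenomena.PercolationContinuityZ3.Theorems
namespace Quant
namespace LawDec

/-! ### Second branch: the low to `3lo+2K` -/

/-- **the second branch's torque cost in the floor regime, `3lo ≤ K ≤ 4lo`** (`θ = y`, `T < 3lo+2K`): exhausted middle-low credit
`K·u₁ < (T−6lo)(u₀+u₁)` and `T ≤ T₀` give `0 ≤ (T₀ − xT)(u₀(T−3lo) + u₁(T−3lo−K)) − (3lo+2K−T)·xT·u₀`. [this work] -/
theorem tripleWide_costMid (lo K g₁ g₂ g₃ x T : ℝ) (hlo0 : 0 < lo) (hK3R : 3 * lo ≤ K) (hK4R : K ≤ 4 * lo) (hg : lo ≤ K * g₁)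
    (h12 : g₁ ≤ g₂) (h13 : g₁ ≤ g₃) (h21 : g₂ < 1) (h31 : g₃ < 1) (hx0 : 0 < x) (hxg : x * (lo + K) ≤ lo + K * g₁)
    (hbr' : K * (g₁ * (1 - g₂) * (1 - g₃) + g₂ * (1 - g₁) * (1 - g₃) + g₃ * (1 - g₁) * (1 - g₂))
      < (T - 6 * lo) * ((1 - g₁) * (1 - g₂) * (1 - g₃) + (g₁ * (1 - g₂) * (1 - g₃) + g₂ * (1 - g₁) * (1 - g₃) + g₃ * (1 - g₁) * (1 - g₂))))
    (hTle : T ≤ 3 * lo + K * (g₁ + g₂ + g₃)) (hT2 : T ≤ 3 * lo + 2 * K) :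
    0 ≤ (3 * lo + K * (g₁ + g₂ + g₃) - x * T)
        * ((1 - g₁) * (1 - g₂) * (1 - g₃) * (T - 3 * lo) + (g₁ * (1 - g₂) * (1 - g₃) + g₂ * (1 - g₁) * (1 - g₃) + g₃ * (1 - g₁) * (1 - g₂)) * (T - (3 * lo + K)))
      - (3 * lo + 2 * K - T) * (x * T) * ((1 - g₁) * (1 - g₂) * (1 - g₃)) := by
  have hK0 : (0 : ℝ) < K := by linarith
  have hg10 : 0 < g₁ := by
    by_contra hc; push Not at hc
    have : K * g₁ ≤ 0 := mul_nonpos_of_nonneg_of_nonpos hK0.le hc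
    linarith
  have hg11 : g₁ < 1 := lt_of_le_of_lt h12 h21
  have hg2 : 0 ≤ g₂ := le_trans hg10.le h12
  have hg3 : 0 ≤ g₃ := le_trans hg10.le h13
  set u0 : ℝ := (1 - g₁) * (1 - g₂) * (1 - g₃) with hu0
  set u1 : ℝ := g₁ * (1 - g₂) * (1 - g₃) + g₂ * (1 - g₁) * (1 - g₃) + g₃ * (1 - g₁) * (1 - g₂) with hu1
  set u2 : ℝ := g₁ * g₂ * (1 - g₃) + g₁ * g₃ * (1 - g₂) + g₂ * g₃ * (1 - g₁) with hu2
  set u3 : ℝ := g₁ * g₂ * g₃ with hu3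
  have hu0p : 0 < u0 := mul_pos (mul_pos (by linarith) (by linarith)) (by linarith)
  have hu1n : 0 ≤ u1 := by rw [hu1]; positivity
  have hu2n : 0 ≤ u2 := by
    rw [hu2]
    have : 0 ≤ 1 - g₁ := by linarith
    have : 0 ≤ 1 - g₂ := by linarith
    have : 0 ≤ 1 - g₃ := by linarith
    positivity
  have hu3n : 0 ≤ u3 := by rw [hu3]; positivity
  set W : ℝ := u0 + u1 with hW
  have hWp : 0 < W := by linarith
  have hWne : W ≠ 0 := hWp.ne'
  set T₀ : ℝ := 3 * lo + K * (g₁ + g₂ + g₃) with hT₀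
  have hT0p : 0 < T₀ := by
    have := mul_pos hK0 (by linarith : 0 < g₁ + g₂ + g₃); rw [hT₀]; linarith
  have hT0top : T₀ < 3 * lo + 3 * K := by
    have := mul_lt_mul_of_pos_left (by linarith : g₁ + g₂ + g₃ < 3) hK0; rw [hT₀]; linarith
  have hB0 : (0 : ℝ) < lo + K := by linarith
  set D : ℝ := T - 6 * lo with hD
  have hDle : D ≤ K * (g₁ + g₂ + g₃) - 3 * lo := by rw [hD]; rw [hT₀] at hTle; linarith
  -- the middle-low credit is exhausted at `a = 1`
  have htopAlg : K * u1 < (K * (g₁ + g₂ + g₃) - 3 * lo) * W := by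
    have : D * W ≤ (K * (g₁ + g₂ + g₃) - 3 * lo) * W := mul_le_mul_of_nonneg_right hDle hWp.le
    linarith
  have hx1 : x < 1 := by
    have : lo + K * g₁ < lo + K := by have := mul_lt_mul_of_pos_left hg11 hK0; linarith
    by_contra hc; push Not at hc
    have : 1 * (lo + K) ≤ x * (lo + K) := mul_le_mul_of_nonneg_right hc hB0.le
    linarith
  have hxu2 : x * (u0 + u2) ≤ u2 := by
    have h1 := ltTriple_capTop_wide lo K g₁ g₂ g₃ hlo0 hK3R hK4R hg h12 h13 h21.le h31.le
      (by have h := htopAlg.le; rw [hW, hu0, hu1] at h; exact h)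
    rw [← hu0, ← hu2] at h1
    have h2 : x * (lo + K) * (u0 + u2) ≤ (lo + K * g₁) * (u0 + u2) :=
      mul_le_mul_of_nonneg_right hxg (add_nonneg hu0p.le hu2n)
    have h3 : (lo + K) * (x * (u0 + u2)) ≤ (lo + K) * u2 := by linarith
    exact le_of_mul_le_mul_left h3 hB0
  -- the quadratic `Ψ(S) = (T₀ − xS)(u0(S−3lo) + u1(S−3lo−K)) − (3lo+2K−S)·xS·u0`
  set α : ℝ := -(T₀ * (3 * lo * u0 + (3 * lo + K) * u1)) with hα
  set β : ℝ := T₀ * (u0 + u1) + x * (3 * lo * u0 + (3 * lo + K) * u1) - (3 * lo + 2 * K) * x * u0 with hβ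
  set κ : ℝ := x * u1 with hκ
  have eΨ : ∀ S : ℝ, (T₀ - x * S) * (u0 * (S - 3 * lo) + u1 * (S - (3 * lo + K))) - (3 * lo + 2 * K - S) * (x * S) * u0
      = α + β * S - κ * S ^ 2 := by
    intro S; rw [hα, hβ, hκ]; ring
  -- the right endpoint `S₁ = min(T₀, 3lo+2K)`
  set S₁ : ℝ := min T₀ (3 * lo + 2 * K) with hS₁
  have hTS₁ : T ≤ S₁ := le_min hTle hT2
  have hΨS₁ : 0 ≤ (T₀ - x * S₁) * (u0 * (S₁ - 3 * lo) + u1 * (S₁ - (3 * lo + K))) - (3 * lo + 2 * K - S₁) * (x * S₁) * u0 := by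
    rcases le_total T₀ (3 * lo + 2 * K) with hle | hle
    · have eS : S₁ = T₀ := min_eq_left hle
      rw [eS]
      have torque : u0 * (T₀ - 3 * lo) + u1 * (T₀ - (3 * lo + K)) = u2 * (3 * lo + 2 * K - T₀) + u3 * (3 * lo + 3 * K - T₀) := by
        rw [hu0, hu1, hu2, hu3, hT₀]; ring
      rw [torque]
      have e : (T₀ - x * T₀) * (u2 * (3 * lo + 2 * K - T₀) + u3 * (3 * lo + 3 * K - T₀)) - (3 * lo + 2 * K - T₀) * (x * T₀) * u0
          = T₀ * (3 * lo + 2 * K - T₀) * (u2 - x * (u0 + u2)) + T₀ * (1 - x) * u3 * (3 * lo + 3 * K - T₀) := by ring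
      rw [e]
      have t1 : 0 ≤ T₀ * (3 * lo + 2 * K - T₀) * (u2 - x * (u0 + u2)) := mul_nonneg (mul_nonneg hT0p.le (by linarith)) (by linarith)
      have t2 : 0 ≤ T₀ * (1 - x) * u3 * (3 * lo + 3 * K - T₀) :=
        mul_nonneg (mul_nonneg (mul_nonneg hT0p.le (by linarith)) hu3n) (by linarith)
      linarith
    · have eS : S₁ = 3 * lo + 2 * K := min_eq_right hle
      rw [eS]
      have e : (T₀ - x * (3 * lo + 2 * K)) * (u0 * (3 * lo + 2 * K - 3 * lo) + u1 * (3 * lo + 2 * K - (3 * lo + K)))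
          - (3 * lo + 2 * K - (3 * lo + 2 * K)) * (x * (3 * lo + 2 * K)) * u0 = (T₀ - x * (3 * lo + 2 * K)) * (2 * K * u0 + K * u1) := by ring
      rw [e]
      have h1 : x * (3 * lo + 2 * K) ≤ T₀ := by
        have h1a : x * (3 * lo + 2 * K) ≤ x * T₀ := mul_le_mul_of_nonneg_left hle hx0.le
        have h1b : x * T₀ ≤ 1 * T₀ := mul_le_mul_of_nonneg_right hx1.le hT0p.le
        linarith
      exact mul_nonneg (by linarith) (by positivity)
  -- the switching point `τ = 6lo + K·u1/W`
  set τ : ℝ := 6 * lo + K * u1 / W with hτ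
  have hτW : τ * W = 6 * lo * W + K * u1 := by rw [hτ, add_mul, div_mul_cancel₀ _ hWne]
  have hτT : τ ≤ T := by
    have hDW : D * W = T * W - 6 * lo * W := by rw [hD]; ring
    have : τ * W ≤ T * W := by rw [hτW]; linarith
    exact le_of_mul_le_mul_right this hWp
  have hτT0 : τ ≤ T₀ := le_trans hτT hTle
  have hC0 := ltTriple_cost0_wide lo K g₁ g₂ g₃ x hlo0 hK3R hK4R hg h12 h13 h21.le h31.le hxg
  rw [← hu0, ← hu1, ← hW] at hC0
  have hΨτ : 0 ≤ (T₀ - x * τ) * (u0 * (τ - 3 * lo) + u1 * (τ - (3 * lo + K))) - (3 * lo + 2 * K - τ) * (x * τ) * u0 := by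
    have e1 : u0 * (τ - 3 * lo) + u1 * (τ - (3 * lo + K)) = 3 * lo * W := by
      have : (u0 * (τ - 3 * lo) + u1 * (τ - (3 * lo + K))) * W = (3 * lo * W) * W := by
        have e : (u0 * (τ - 3 * lo) + u1 * (τ - (3 * lo + K))) * W
            = (τ * W) * (u0 + u1) - (3 * lo * u0 + (3 * lo + K) * u1) * W := by ring
        rw [e, hτW, hW]; ring
      exact mul_right_cancel₀ hWne this
    have e2 : (3 * lo + 2 * K - τ) * W = (2 * K - 3 * lo) * u0 + (K - 3 * lo) * u1 := by
      have e : (3 * lo + 2 * K - τ) * W = (3 * lo + 2 * K) * W - τ * W := by ring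
      rw [e, hτW, hW]; ring
    rw [e1]
    have key : 0 ≤ ((T₀ - x * τ) * (3 * lo * W) - (3 * lo + 2 * K - τ) * (x * τ) * u0) * W := by
      have e : ((T₀ - x * τ) * (3 * lo * W) - (3 * lo + 2 * K - τ) * (x * τ) * u0) * W
          = (T₀ - x * τ) * (3 * lo * W ^ 2) - (x * τ) * u0 * ((3 * lo + 2 * K - τ) * W) := by ring
      rw [e, e2]
      set br : ℝ := (2 * K - 3 * lo) * u0 + (K - 3 * lo) * u1 with hbr
      have hbr0 : 0 ≤ br := by
        rw [hbr]; exact add_nonneg (mul_nonneg (by linarith) hu0p.le) (mul_nonneg (by linarith) hu1n)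
      have m1 : T₀ - x * T₀ ≤ T₀ - x * τ := by have := mul_le_mul_of_nonneg_left hτT0 hx0.le; linarith
      have m5 : (T₀ - x * T₀) * (3 * lo * W ^ 2) ≤ (T₀ - x * τ) * (3 * lo * W ^ 2) := mul_le_mul_of_nonneg_right m1 (by positivity)
      have m2 : (x * τ) * u0 * br ≤ (x * T₀) * u0 * br :=
        mul_le_mul_of_nonneg_right (mul_le_mul_of_nonneg_right (mul_le_mul_of_nonneg_left hτT0 hx0.le) hu0p.le) hbr0
      have m3 : (T₀ - x * T₀) * (3 * lo * W ^ 2) - (x * T₀) * u0 * br = T₀ * (3 * lo * (1 - x) * W ^ 2 - x * u0 * br) := by ring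
      have m4 : 0 ≤ T₀ * (3 * lo * (1 - x) * W ^ 2 - x * u0 * br) := mul_nonneg hT0p.le (by rw [hbr]; linarith)
      linarith
    exact nonneg_of_mul_nonneg_left key hWp
  -- concavity between `τ` and `S₁`
  have h1 : 0 ≤ α + β * τ - κ * τ ^ 2 := by rw [← eΨ τ]; exact hΨτ
  have h2 : 0 ≤ α + β * S₁ - κ * S₁ ^ 2 := by rw [← eΨ S₁]; exact hΨS₁
  have hquad := quad_concave_between (by rw [hκ]; exact mul_nonneg hx0.le hu1n) h1 h2 hτT hTS₁
  rw [eΨ T]; exact hquad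

/-! ### Two lows to the top -/

/-- **the top route's torque cost in the floor regime, two lows** (`3lo ≤ K ≤ 7lo/2`, `θ = y`, `6lo+2K ≤ T ≤ T₀`):
`0 ≤ (T₀ − xT)(u₀(T−3lo) + u₁(T−3lo−K) + u₂(T−3lo−2K)) − (3lo+3K−T)·xT·(u₀+u₁)`. [this work] -/
theorem tripleWide_costTopTwo (lo K g₁ g₂ g₃ x T : ℝ) (hlo0 : 0 < lo) (hK3R : 3 * lo ≤ K) (hK72 : 2 * K ≤ 7 * lo) (hg : lo ≤ K * g₁)
    (h12 : g₁ ≤ g₂) (h13 : g₁ ≤ g₃) (h21 : g₂ < 1) (h31 : g₃ < 1) (hx0 : 0 < x) (hxg : x * (lo + K) ≤ lo + K * g₁)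
    (hT6 : 6 * lo + 2 * K ≤ T) (hTle : T ≤ 3 * lo + K * (g₁ + g₂ + g₃)) :
    0 ≤ (3 * lo + K * (g₁ + g₂ + g₃) - x * T)
        * ((1 - g₁) * (1 - g₂) * (1 - g₃) * (T - 3 * lo)
          + (g₁ * (1 - g₂) * (1 - g₃) + g₂ * (1 - g₁) * (1 - g₃) + g₃ * (1 - g₁) * (1 - g₂)) * (T - (3 * lo + K))
          + (g₁ * g₂ * (1 - g₃) + g₁ * g₃ * (1 - g₂) + g₂ * g₃ * (1 - g₁)) * (T - (3 * lo + 2 * K)))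
      - (3 * lo + 3 * K - T) * (x * T)
        * ((1 - g₁) * (1 - g₂) * (1 - g₃) + (g₁ * (1 - g₂) * (1 - g₃) + g₂ * (1 - g₁) * (1 - g₃) + g₃ * (1 - g₁) * (1 - g₂))) := by
  have hK0 : (0 : ℝ) < K := by linarith
  have hg10 : 0 < g₁ := by
    by_contra hc; push Not at hc
    have : K * g₁ ≤ 0 := mul_nonpos_of_nonneg_of_nonpos hK0.le hc
    linarith
  have hg11 : g₁ < 1 := lt_of_le_of_lt h12 h21
  have hg2 : 0 ≤ g₂ := le_trans hg10.le h12
  have hg3 : 0 ≤ g₃ := le_trans hg10.le h13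
  have hg₂K : lo ≤ K * g₂ := le_trans hg (mul_le_mul_of_nonneg_left h12 hK0.le)
  have hg₃K : lo ≤ K * g₃ := le_trans hg (mul_le_mul_of_nonneg_left h13 hK0.le)
  set u0 : ℝ := (1 - g₁) * (1 - g₂) * (1 - g₃) with hu0
  set u1 : ℝ := g₁ * (1 - g₂) * (1 - g₃) + g₂ * (1 - g₁) * (1 - g₃) + g₃ * (1 - g₁) * (1 - g₂) with hu1
  set u2 : ℝ := g₁ * g₂ * (1 - g₃) + g₁ * g₃ * (1 - g₂) + g₂ * g₃ * (1 - g₁) with hu2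
  set u3 : ℝ := g₁ * g₂ * g₃ with hu3
  have hu0p : 0 < u0 := mul_pos (mul_pos (by linarith) (by linarith)) (by linarith)
  have hu1n : 0 ≤ u1 := by rw [hu1]; positivity
  have hu2n : 0 ≤ u2 := by
    rw [hu2]
    have : 0 ≤ 1 - g₁ := by linarith
    have : 0 ≤ 1 - g₂ := by linarith
    have : 0 ≤ 1 - g₃ := by linarith
    positivity
  have hu3n : 0 ≤ u3 := by rw [hu3]; positivity
  set W : ℝ := u0 + u1 with hW
  have hWp : 0 < W := by linarith
  set T₀ : ℝ := 3 * lo + K * (g₁ + g₂ + g₃) with hT₀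
  have hT0p : 0 < T₀ := by
    have := mul_pos hK0 (by linarith : 0 < g₁ + g₂ + g₃); rw [hT₀]; linarith
  have hT0top : T₀ < 3 * lo + 3 * K := by
    have := mul_lt_mul_of_pos_left (by linarith : g₁ + g₂ + g₃ < 3) hK0; rw [hT₀]; linarith
  have hB0 : (0 : ℝ) < lo + K := by linarith
  have hL2 : 2 * K ≤ K * (g₁ + g₂ + g₃) - 3 * lo := by rw [hT₀] at hTle; linarith
  have hx1 : x < 1 := by
    have : lo + K * g₁ < lo + K := by have := mul_lt_mul_of_pos_left hg11 hK0; linarith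
    by_contra hc; push Not at hc
    have : 1 * (lo + K) ≤ x * (lo + K) := mul_le_mul_of_nonneg_right hc hB0.le
    linarith
  -- the two-low floor capacity of the top (`ltTop_capTop_two`)
  have hxu3 : x * (W + u3) ≤ u3 := by
    have h1 := ltTop_capTop_two lo K g₁ g₂ g₃ hlo0 hK3R hK72 hg hg₂K hg₃K h12 h13 hg11.le h21.le h31.le hL2
    rw [← hu0, ← hu1, ← hu3, ← hW] at h1
    have h2 : x * (lo + K) * (W + u3) ≤ (lo + K * g₁) * (W + u3) :=
      mul_le_mul_of_nonneg_right hxg (add_nonneg hWp.le hu3n)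
    have h3 : (lo + K) * (x * (W + u3)) ≤ (lo + K) * u3 := by linarith
    exact le_of_mul_le_mul_left h3 hB0
  -- the quadratic `Ψ₂(S) = (T₀ − xS)(u0(S−3lo) + u1(S−3lo−K) + u2(S−3lo−2K)) − (3lo+3K−S)·xS·W`
  set α : ℝ := -(T₀ * (3 * lo * u0 + (3 * lo + K) * u1 + (3 * lo + 2 * K) * u2)) with hα
  set β : ℝ := T₀ * (u0 + u1 + u2) + x * (3 * lo * u0 + (3 * lo + K) * u1 + (3 * lo + 2 * K) * u2) - (3 * lo + 3 * K) * x * W with hβ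
  set κ : ℝ := x * u2 with hκ
  have eΨ : ∀ S : ℝ, (T₀ - x * S) * (u0 * (S - 3 * lo) + u1 * (S - (3 * lo + K)) + u2 * (S - (3 * lo + 2 * K)))
      - (3 * lo + 3 * K - S) * (x * S) * W = α + β * S - κ * S ^ 2 := by
    intro S; rw [hα, hβ, hκ, hW]; ring
  -- right end `T₀`: torque identity and the floor capacity
  have h2 : 0 ≤ α + β * T₀ - κ * T₀ ^ 2 := by
    rw [← eΨ T₀]
    have torque : u0 * (T₀ - 3 * lo) + u1 * (T₀ - (3 * lo + K)) + u2 * (T₀ - (3 * lo + 2 * K)) = u3 * (3 * lo + 3 * K - T₀) := by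
      rw [hu0, hu1, hu2, hu3, hT₀]; ring
    rw [torque]
    have e : (T₀ - x * T₀) * (u3 * (3 * lo + 3 * K - T₀)) - (3 * lo + 3 * K - T₀) * (x * T₀) * W
        = T₀ * (3 * lo + 3 * K - T₀) * (u3 - x * (W + u3)) := by ring
    rw [e]
    exact mul_nonneg (mul_nonneg hT0p.le (by linarith)) (by linarith)
  -- left end `6lo+2K`: `ltTop_cost2_max`
  have h1 : 0 ≤ α + β * (6 * lo + 2 * K) - κ * (6 * lo + 2 * K) ^ 2 := by
    rw [← eΨ (6 * lo + 2 * K)]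
    set B : ℝ := u0 * (3 * lo + 2 * K) + u1 * (3 * lo + K) + u2 * (3 * lo) with hB
    have hB0' : 0 ≤ B := by
      rw [hB]; exact add_nonneg (add_nonneg (mul_nonneg hu0p.le (by linarith)) (mul_nonneg hu1n (by linarith))) (mul_nonneg hu2n (by linarith))
    have e : (T₀ - x * (6 * lo + 2 * K)) * (u0 * (6 * lo + 2 * K - 3 * lo) + u1 * (6 * lo + 2 * K - (3 * lo + K)) + u2 * (6 * lo + 2 * K - (3 * lo + 2 * K)))
        - (3 * lo + 3 * K - (6 * lo + 2 * K)) * (x * (6 * lo + 2 * K)) * W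
        = (T₀ - x * (6 * lo + 2 * K)) * B - (K - 3 * lo) * (x * (6 * lo + 2 * K)) * W := by rw [hB]; ring
    rw [e]
    have hC2 := ltTop_cost2_max lo K g₁ g₂ g₃ hlo0 hK3R hK72 hg hg₂K hg₃K h12 h13 hg11.le h21.le h31.le hL2
    rw [← hu0, ← hu1, ← hu2, ← hW, ← hT₀, ← hB] at hC2
    have hm0 : (0 : ℝ) ≤ 6 * lo + 2 * K := by linarith
    have f1 : x * (lo + K) * ((6 * lo + 2 * K) * W) ≤ (lo + K * g₁) * ((6 * lo + 2 * K) * W) :=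
      mul_le_mul_of_nonneg_right hxg (mul_nonneg hm0 hWp.le)
    have f2 : (K - 3 * lo) * (x * (lo + K) * ((6 * lo + 2 * K) * W)) ≤ (K - 3 * lo) * ((lo + K * g₁) * ((6 * lo + 2 * K) * W)) :=
      mul_le_mul_of_nonneg_left f1 (by linarith)
    have f3 : x * (lo + K) * (6 * lo + 2 * K) * B ≤ (lo + K * g₁) * (6 * lo + 2 * K) * B :=
      mul_le_mul_of_nonneg_right (mul_le_mul_of_nonneg_right hxg hm0) hB0'
    have f4 : 0 ≤ (lo + K) * ((T₀ - x * (6 * lo + 2 * K)) * B - (K - 3 * lo) * (x * (6 * lo + 2 * K)) * W) := by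
      have e : (lo + K) * ((T₀ - x * (6 * lo + 2 * K)) * B - (K - 3 * lo) * (x * (6 * lo + 2 * K)) * W)
          = (T₀ * (lo + K)) * B - x * (lo + K) * (6 * lo + 2 * K) * B - (K - 3 * lo) * (x * (lo + K) * ((6 * lo + 2 * K) * W)) := by ring
      rw [e]
      have e2 : (K - 3 * lo) * (lo + K * g₁) * (6 * lo + 2 * K) * W = (K - 3 * lo) * ((lo + K * g₁) * ((6 * lo + 2 * K) * W)) := by ring
      have e3 : (T₀ * (lo + K) - (lo + K * g₁) * (6 * lo + 2 * K)) * B = (T₀ * (lo + K)) * B - (lo + K * g₁) * (6 * lo + 2 * K) * B := by ring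
      rw [e2, e3] at hC2
      linarith [hC2, f2, f3]
    exact nonneg_of_mul_nonneg_right f4 hB0
  have hκ0 : 0 ≤ κ := by rw [hκ]; exact mul_nonneg hx0.le hu2n
  have hquad := quad_concave_between hκ0 h1 h2 hT6 hTle
  rw [eΨ T]; exact hquad

end LawDec
end Quant
end Summit.CriticalPhenomena.PercolationContinuityZ3.Theorems
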